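import Literature.MathematicalPhysics.QuantumFieldTheory.Balaban1983to89.Beta.WilsonWardJets2

/-!
# The `(2,2)`-jet of ONE plaquette word under the two axis-reflection readings, with its contact (per-plaquette ring identities)

HONEST FRAMING (cell `pub-balaban`, β sub-cell, lineage an3; verbatim): discharging `BetaPertH` makes Bałaban's UV stability
UNCONDITIONAL — a real constructive-QFT result; it is NOT the continuum limit and NOT the Clay problem.  This file discharges NOTHING
of `BetaPertH`.  ABSOLUTE RULE of the cell (verbatim): «No internally-minted statement may enter as a cited fact. Every hypothesis is
either kernel-proved in this package or a verbatim quotation of a PUBLISHED theorem with page reference. The manuscript(s) under audit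
are NOT citable for their own disputed steps — they are the thing under adjudication; programme-internal (2001/route/tribunal) claims
are never citable.»  Accordingly every declaration below is kernel-proved here from the imports; NOTHING is cited; no `def … : Prop`
occurs (no `def` at all).  HONEST DEPENDENCY (unchanged by this file): continuum YM on `T⁴` ⇐ `BetaPertH` ∧ nine spine estimates
(0/9 proved); `BetaPertH` ⇐ (D1) ∧ (D4) ∧ CAP+tail.

## What is proved

Setting of `Summits.QuantumFields.BalabanUV.Beta.WilsonJetReflection` (read its header), ONE BACKGROUND ORDER UP: the chart
`U_b = e^{W_b}·e^{B_b}` ([Balaban1985BackgroundPropagators] (3.1) p. 390) = `Beta.WilsonVertex.plaq`, the graded components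
`F_{2,2} = τ∘P22` (`Beta.WilsonVertex2.P22`), `F_{2,1} = τ∘P21`, `F_{2,0} = τ∘quad∘wpart` of `τ U(∂p)`.  Under an axis reflection the
pulled-back plaquette word of a plaquette containing the reflected axis `α` is the word of the image plaquette READ IN ONE OF TWO
REFLECTED WAYS (`WilsonJetReflection.trace_P21_plaqWord_pull_fst/snd`): first kind `plaq (−W₄) W₁ (−W₂) W₃ (−B₄) B₁ (−B₂) B₃` (the
`α`-bonds are the slots `2, 4` of the image word), second kind `plaq W₂ (−W₃) W₄ (−W₁) B₂ (−B₃) B₄ (−B₁)` (`α`-bonds = slots `1, 3`).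
At order `(2,1)` the reflected readings differ from the straight one by the contact `τ(Z_W·([B_s,W_s] − [B_{s'},W_{s'}]))`
(`WilsonJetReflection.trace_P21_plaq_reflect₁/₂`).  THIS FILE gives the order-`(2,2)` law, for EVERY ring `𝔸`, every `𝕜`-linear
TRACIAL `τ`, ALL LETTERS (`four_smul_trace_P22_plaq_reflect₁`, `…₂`, §2), in the integer form (`×4`) of the Ward series
(`Beta.WilsonWardJets2.four_smul_trace_P22 / four_smul_trace_P21`, `Beta.WilsonWardJets.two_smul_trace_quad`):

  `4·F_{2,2}(reflected reading) = 4·F_{2,2}(w; b) + 4·Pol F_{2,1}(w, E₁; b) + 2·Pol F_{2,0}(w, D) + 4·F_{2,0}(E₁)`          (R₂)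

with `Pol f(u,v) = f(u+v) − f(u) − f(v)` and the two CONTACT DIRECTIONS supported on the `α`-slots `s` only:
`(E₁)_s = [B_s, W_s] = B_s·W_s − W_s·B_s`, `D_s = [B_s,[B_s,W_s]]` (so `2·Pol F_{2,0}(w, D) = 4·Pol F_{2,0}(w, ½D)`), zero on the other
two slots.  DICTIONARY (why these directions): on an `α`-bond the reflected link is `U_α(σx − e_α)⁻¹ = e^{−B}e^{−W} = e^{W′}e^{−B}` with
`W′ = −e^{−B}We^{B} = −(W − [B,W] + ½[B,[B,W]] − …)`, so the pulled-back fluctuation in the product chart is the reflected one composed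
with `Φ_B = 1 − ad_B + ½ad_B² − …`; inverting, `F(pull W, pull B) = F(W + E₁W + ½D W + O(B³), B)` for the full plaquette functional,
and (R₂) is its bidegree-`(2,2)` component (`F_{2,0}` quadratic, `F_{2,1}` quadratic in `W` and linear in `B`).  §1: `four_smul_trace_quad`.

METHOD (that of `Beta.WilsonWardColumns2`, verbatim pipeline): the integer normal forms `four_smul_trace_P22`, `four_smul_trace_P21`,
`two_smul_trace_quad` turn both sides into `τ` of explicit integer polynomials in the eight letters; the collected difference
(`545` / `544` monomials) is ONE commutator sum `Σ_a [a, P_a]` grouped by the left letter (`WilsonWardJets.csum`; certificates `385` /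
`375` monomials), checked by `noncomm_ring`, and `τ` kills it (`WilsonWardJets.trace_eq_of_sub_eq_csum`).  Statements and certificates
were generated, and (R₂) together with its lattice sum (`Summits…Beta.WilsonJetReflection2.jet22_pull`) evaluated with `τ = tr` on
random integer matrices in exact arithmetic on the tori `(ℤ/3)², ℤ/4×ℤ/3, (ℤ/3)³` for every axis (`0` failures), by the archived
engines `b2b-balaban-beta-an3/gen31/toy/{p22toy.py, ncpoly.py, reflect_gen.py}`; the kernel re-verifies everything and trusts nothing.
`maxHeartbeats` is raised for the two certificate theorems only.

## What this file does NOT do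

No lattice sum (that is `Summits…Beta.WilsonJetReflection2`), no coordinates / spin tables / stencil reading (the `(2,2)` analogue of
`WilsonStencilReflection` / `WilsonReflectionContact` is the NEXT leaf), nothing at order `B³`, no estimate; it moves no wall statement;
it is not summit progress, not the continuum limit, not Clay.  [folklore] throughout: multilinear algebra in an arbitrary normed algebra.
-/

namespace Summit.QuantumFields.BalabanUV.Beta.WilsonJetReflect2Plaq

open Literature.MathematicalPhysics.QuantumFieldTheory.Balaban1983to89.Beta.TransportVertices
open Literature.MathematicalPhysics.QuantumFieldTheory.Balaban1983to89.Beta.WilsonVertex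
open Literature.MathematicalPhysics.QuantumFieldTheory.Balaban1983to89.Beta.WilsonVertex2
open Literature.MathematicalPhysics.QuantumFieldTheory.Balaban1983to89.Beta.SpinTable (br)
open Literature.MathematicalPhysics.QuantumFieldTheory.Balaban1983to89.Beta.WilsonWardJets
  (csum csum_nil csum_cons trace_eq_of_sub_eq_csum two_smul_trace_quad)
open Literature.MathematicalPhysics.QuantumFieldTheory.Balaban1983to89.Beta.WilsonWardJets2
  (two_smul_twist₂_plaq four_smul_trace_P22 four_smul_trace_P21)

variable (𝕜 : Type*) [RCLike 𝕜] {𝔸 : Type*} [NormedRing 𝔸] [NormedAlgebra 𝕜 𝔸]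
variable {V : Type*} [AddCommGroup V] [Module 𝕜 V]
variable (τ : 𝔸 →ₗ[𝕜] V) (W₁ W₂ W₃ W₄ B₁ B₂ B₃ B₄ : 𝔸)

/-! ## §1 The integer normal form of `4·F_{2,0}` -/

/-- `4·τ(quad l) = τ((Σl)² + commSum l + ((Σl)² + commSum l))` — twice `WilsonWardJets.two_smul_trace_quad`. [folklore] -/
theorem four_smul_trace_quad (l : List 𝔸) :
    (4 : 𝕜) • τ (quad 𝕜 l) = τ (l.sum * l.sum + commSum l + (l.sum * l.sum + commSum l)) := by
  rw [show (4 : 𝕜) = 2 * 2 by norm_num, mul_smul, two_smul_trace_quad 𝕜 τ l, two_smul, ← map_add]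

/-! ## §2 The two reflected readings at order `(2,2)` -/

set_option maxHeartbeats 16000000 in
set_option maxRecDepth 100000 in
/-- **(R₂), FIRST KIND** (`α`-slots `2, 4`): `4·τP22(plaq (−W₄) W₁ (−W₂) W₃ (−B₄) B₁ (−B₂) B₃) = 4·τP22(plaq W B) + 4·Pol τP21(W, E₁; B)
+ 2·Pol τquad∘wpart(W, D) + 4·τquad∘wpart(E₁)` with `E₁ = (0, [B₂,W₂], 0, [B₄,W₄])`, `D = (0, [B₂,[B₂,W₂]], 0, [B₄,[B₄,W₄]])`.
Every ring, every tracial `τ`, all letters; collected difference 545 monomials, certificate 385. [folklore] -/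
theorem four_smul_trace_P22_plaq_reflect₁ (hτ : ∀ a b : 𝔸, τ (a * b) = τ (b * a)) :
    (4 : 𝕜) • τ (P22 𝕜 (plaq (-W₄) W₁ (-W₂) W₃ (-B₄) B₁ (-B₂) B₃)) =
      (4 : 𝕜) • τ (P22 𝕜 (plaq W₁ W₂ W₃ W₄ B₁ B₂ B₃ B₄))
        + ((4 : 𝕜) • τ (P21 𝕜 (plaq W₁ (W₂ + (B₂ * W₂ - W₂ * B₂)) W₃ (W₄ + (B₄ * W₄ - W₄ * B₄)) B₁ B₂ B₃ B₄))
            - (4 : 𝕜) • τ (P21 𝕜 (plaq W₁ W₂ W₃ W₄ B₁ B₂ B₃ B₄))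
            - (4 : 𝕜) • τ (P21 𝕜 (plaq 0 (B₂ * W₂ - W₂ * B₂) 0 (B₄ * W₄ - W₄ * B₄) B₁ B₂ B₃ B₄)))
        + ((2 : 𝕜) • τ (quad 𝕜 (wpart (plaq W₁ (W₂ + (B₂ * (B₂ * W₂ - W₂ * B₂) - (B₂ * W₂ - W₂ * B₂) * B₂)) W₃
              (W₄ + (B₄ * (B₄ * W₄ - W₄ * B₄) - (B₄ * W₄ - W₄ * B₄) * B₄)) B₁ B₂ B₃ B₄)))
            - (2 : 𝕜) • τ (quad 𝕜 (wpart (plaq W₁ W₂ W₃ W₄ B₁ B₂ B₃ B₄)))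
            - (2 : 𝕜) • τ (quad 𝕜 (wpart (plaq 0 (B₂ * (B₂ * W₂ - W₂ * B₂) - (B₂ * W₂ - W₂ * B₂) * B₂) 0
              (B₄ * (B₄ * W₄ - W₄ * B₄) - (B₄ * W₄ - W₄ * B₄) * B₄) B₁ B₂ B₃ B₄))))
        + (4 : 𝕜) • τ (quad 𝕜 (wpart (plaq 0 (B₂ * W₂ - W₂ * B₂) 0 (B₄ * W₄ - W₄ * B₄) B₁ B₂ B₃ B₄))) := by
  simp only [four_smul_trace_P22 𝕜 τ hτ, four_smul_trace_P21 𝕜 τ hτ, four_smul_trace_quad 𝕜 τ, two_smul_trace_quad 𝕜 τ,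
    two_smul_twist₂_plaq, two_smul_qtwistAux, wpart_plaq, bpart_plaq, twist_plaq, sum_four_signed, two_smul_quad, commSum_four]
  simp only [plaq, ctwistAux_consW, ctwistAux_consB, ctwistAux_nil, twistAux_consW, twistAux_consB, twistAux_nil, wpart_consW,
    wpart_consB, wpart_nil, List.sum_cons, List.sum_nil]
  simp only [← map_add, ← map_sub]
  refine trace_eq_of_sub_eq_csum 𝕜 τ hτ
    [(B₁,
          2 * (B₂ * W₂ * W₁) + 2 * (B₂ * W₂ * W₃) + 2 * (B₂ * W₂ * W₄) - 2 * (B₄ * W₄ * W₁) - 2 * (B₄ * W₄ * W₂) +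
            2 * (B₄ * W₄ * W₃) - 2 * (W₁ * B₂ * W₂) + 2 * (W₁ * B₄ * W₄) + 2 * (W₁ * W₂ * B₂) - 2 * (W₁ * W₄ * B₄) +
            2 * (W₂ * B₁ * W₄) - 2 * (W₂ * B₂ * W₁) + 2 * (W₂ * B₂ * W₂) - 2 * (W₂ * B₂ * W₃) - 2 * (W₂ * B₃ * W₄) -
            2 * (W₂ * B₄ * W₁) - 2 * (W₂ * B₄ * W₂) + 2 * (W₂ * B₄ * W₃) + 2 * (W₂ * W₁ * B₄) - 2 * (W₂ * W₂ * B₂) +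
            2 * (W₂ * W₂ * B₄) - 2 * (W₂ * W₃ * B₄) + 2 * (W₂ * W₄ * B₁) + 2 * (W₂ * W₄ * B₂) - 2 * (W₂ * W₄ * B₃) -
            4 * (W₂ * W₄ * B₄) - 2 * (W₃ * B₁ * W₄) - 4 * (W₃ * B₂ * W₂) - 2 * (W₃ * B₂ * W₄) + 2 * (W₃ * B₃ * W₄) +
            2 * (W₃ * B₄ * W₁) + 2 * (W₃ * B₄ * W₂) - 2 * (W₃ * B₄ * W₃) - 2 * (W₃ * W₁ * B₄) + 4 * (W₃ * W₂ * B₂) -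
            2 * (W₃ * W₂ * B₄) + 2 * (W₃ * W₃ * B₄) - 2 * (W₃ * W₄ * B₁) - 2 * (W₃ * W₄ * B₂) + 2 * (W₃ * W₄ * B₃) +
            4 * (W₃ * W₄ * B₄) + 2 * (W₄ * B₁ * W₂) - 2 * (W₄ * B₁ * W₃) - 2 * (W₄ * B₁ * W₄) - 2 * (W₄ * B₂ * W₂) -
            2 * (W₄ * B₂ * W₃) - 2 * (W₄ * B₂ * W₄) + 2 * (W₄ * B₃ * W₃) + 2 * (W₄ * B₃ * W₄) + 2 * (W₄ * B₄ * W₁) +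
            2 * (W₄ * B₄ * W₂) - 2 * (W₄ * B₄ * W₃) + 2 * (W₄ * B₄ * W₄) - 2 * (W₄ * W₂ * B₁) + 2 * (W₄ * W₂ * B₂) +
            2 * (W₄ * W₃ * B₁) + 2 * (W₄ * W₃ * B₂) - 2 * (W₄ * W₃ * B₃)),
        (B₂,
          2 * (B₂ * W₂ * W₁) - (B₂ * W₂ * W₂) + 4 * (B₂ * W₂ * W₃) + 4 * (B₂ * W₂ * W₄) - 2 * (B₄ * W₄ * W₁) - 2 * (B₄ * W₄ * W₂) +
            2 * (B₄ * W₄ * W₃) - 2 * (W₁ * B₂ * W₂) + 2 * (W₁ * B₄ * W₄) + 2 * (W₁ * W₂ * B₂) - 2 * (W₁ * W₄ * B₄) -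
            2 * (W₂ * B₁ * W₂) + 2 * (W₂ * B₁ * W₄) - 2 * (W₂ * B₂ * W₁) + 2 * (W₂ * B₂ * W₂) - 4 * (W₂ * B₂ * W₃) -
            2 * (W₂ * B₂ * W₄) - 2 * (W₂ * B₃ * W₃) - 4 * (W₂ * B₃ * W₄) - 2 * (W₂ * B₄ * W₁) - 2 * (W₂ * B₄ * W₂) +
            2 * (W₂ * B₄ * W₃) + 2 * (W₂ * B₄ * W₄) + 2 * (W₂ * W₁ * B₃) + 4 * (W₂ * W₁ * B₄) + 2 * (W₂ * W₂ * B₁) - (W₂ * W₂ * B₂)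
            + 2 * (W₂ * W₂ * B₄) - 2 * (W₂ * W₃ * B₁) + 4 * (W₂ * W₃ * B₃) + 2 * (W₂ * W₄ * B₂) + 2 * (W₂ * W₄ * B₃) -
            4 * (W₂ * W₄ * B₄) + 2 * (W₃ * B₁ * W₂) - 2 * (W₃ * B₁ * W₄) - 4 * (W₃ * B₂ * W₂) - 2 * (W₃ * B₂ * W₄) +
            2 * (W₃ * B₃ * W₄) + 2 * (W₃ * B₄ * W₁) + 2 * (W₃ * B₄ * W₂) - 2 * (W₃ * B₄ * W₃) - 2 * (W₃ * W₁ * B₄) +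
            4 * (W₃ * W₂ * B₂) - 2 * (W₃ * W₂ * B₄) + 2 * (W₃ * W₃ * B₄) - 2 * (W₃ * W₄ * B₁) - 2 * (W₃ * W₄ * B₂) +
            2 * (W₃ * W₄ * B₃) + 4 * (W₃ * W₄ * B₄) + 4 * (W₄ * B₁ * W₂) - 2 * (W₄ * B₁ * W₃) - 2 * (W₄ * B₁ * W₄) -
            2 * (W₄ * B₂ * W₂) - 2 * (W₄ * B₂ * W₃) - 2 * (W₄ * B₂ * W₄) + 2 * (W₄ * B₃ * W₃) + 2 * (W₄ * B₃ * W₄) +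
            2 * (W₄ * B₄ * W₁) + 2 * (W₄ * B₄ * W₂) - 2 * (W₄ * B₄ * W₃) + 2 * (W₄ * B₄ * W₄) - 2 * (W₄ * W₂ * B₁) +
            2 * (W₄ * W₂ * B₂) + 2 * (W₄ * W₃ * B₁) + 2 * (W₄ * W₃ * B₂) - 2 * (W₄ * W₃ * B₃)),
        (B₃,
          2 * (B₄ * W₄ * W₁) + 2 * (B₄ * W₄ * W₂) - 2 * (B₄ * W₄ * W₃) + 2 * (W₁ * B₂ * W₂) - 2 * (W₁ * B₄ * W₄) -
            2 * (W₁ * W₂ * B₂) + 2 * (W₁ * W₄ * B₄) - 2 * (W₂ * B₁ * W₄) + 2 * (W₂ * B₂ * W₁) + 4 * (W₂ * B₂ * W₃) +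
            2 * (W₂ * B₂ * W₄) - 2 * (W₂ * B₄ * W₄) + 2 * (W₂ * W₄ * B₄) + 2 * (W₃ * B₁ * W₄) + 2 * (W₃ * B₂ * W₂) +
            2 * (W₃ * B₂ * W₄) - 2 * (W₃ * B₃ * W₄) - 2 * (W₃ * B₄ * W₁) - 2 * (W₃ * B₄ * W₂) + 2 * (W₃ * B₄ * W₃) +
            2 * (W₃ * W₁ * B₄) - 4 * (W₃ * W₂ * B₂) + 2 * (W₃ * W₂ * B₄) - 2 * (W₃ * W₃ * B₄) + 2 * (W₃ * W₄ * B₁) +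
            2 * (W₃ * W₄ * B₂) - 2 * (W₃ * W₄ * B₃) - 4 * (W₃ * W₄ * B₄) - 4 * (W₄ * B₁ * W₂) + 2 * (W₄ * B₁ * W₃) +
            2 * (W₄ * B₁ * W₄) - 2 * (W₄ * B₂ * W₂) + 2 * (W₄ * B₂ * W₃) + 2 * (W₄ * B₂ * W₄) - 2 * (W₄ * B₃ * W₃) -
            2 * (W₄ * B₃ * W₄) - 2 * (W₄ * B₄ * W₁) - 2 * (W₄ * B₄ * W₂) + 2 * (W₄ * B₄ * W₃) - 2 * (W₄ * B₄ * W₄) +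
            2 * (W₄ * W₂ * B₁) - 2 * (W₄ * W₂ * B₂) - 2 * (W₄ * W₃ * B₁) - 2 * (W₄ * W₃ * B₂) + 2 * (W₄ * W₃ * B₃)),
        (B₄,
          2 * (B₄ * W₄ * W₁) + 2 * (B₄ * W₄ * W₂) - 2 * (B₄ * W₄ * W₃) - (B₄ * W₄ * W₄) - 4 * (W₁ * B₁ * W₂) + 4 * (W₁ * B₁ * W₃) +
            4 * (W₁ * B₁ * W₄) - 2 * (W₁ * B₂ * W₂) + 4 * (W₁ * B₂ * W₃) + 4 * (W₁ * B₂ * W₄) - 4 * (W₁ * B₃ * W₃) -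
            4 * (W₁ * B₃ * W₄) + 2 * (W₁ * B₄ * W₁) + 2 * (W₁ * B₄ * W₂) - 2 * (W₁ * B₄ * W₃) - 2 * (W₁ * B₄ * W₄) -
            2 * (W₁ * W₁ * B₁) - 2 * (W₁ * W₁ * B₂) + 2 * (W₁ * W₁ * B₃) - 2 * (W₁ * W₂ * B₁) - 4 * (W₁ * W₂ * B₂) +
            4 * (W₁ * W₂ * B₃) + 2 * (W₁ * W₂ * B₄) + 2 * (W₁ * W₃ * B₁) + 2 * (W₁ * W₃ * B₂) - 2 * (W₁ * W₃ * B₃) -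
            2 * (W₁ * W₃ * B₄) + 2 * (W₁ * W₄ * B₄) + 2 * (W₂ * B₁ * W₁) - 2 * (W₂ * B₁ * W₂) + 2 * (W₂ * B₁ * W₃) +
            2 * (W₂ * B₁ * W₄) + 4 * (W₂ * B₂ * W₁) - 2 * (W₂ * B₂ * W₂) + 4 * (W₂ * B₂ * W₃) + 2 * (W₂ * B₂ * W₄) -
            4 * (W₂ * B₃ * W₃) - 4 * (W₂ * B₃ * W₄) + 2 * (W₂ * B₄ * W₁) + 2 * (W₂ * B₄ * W₂) - 2 * (W₂ * B₄ * W₃) -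
            2 * (W₂ * B₄ * W₄) - 2 * (W₂ * W₁ * B₄) + 2 * (W₂ * W₂ * B₃) + 2 * (W₂ * W₃ * B₁) + 2 * (W₂ * W₃ * B₂) -
            2 * (W₂ * W₃ * B₃) - 2 * (W₂ * W₃ * B₄) + 2 * (W₂ * W₄ * B₄) - 2 * (W₃ * B₁ * W₁) + 2 * (W₃ * B₁ * W₂) -
            2 * (W₃ * B₁ * W₃) - 2 * (W₃ * B₁ * W₄) - 2 * (W₃ * B₂ * W₁) + 4 * (W₃ * B₂ * W₂) - 2 * (W₃ * B₂ * W₃) -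
            2 * (W₃ * B₂ * W₄) + 2 * (W₃ * B₃ * W₁) + 2 * (W₃ * B₃ * W₂) + 2 * (W₃ * B₃ * W₃) + 2 * (W₃ * B₃ * W₄) -
            2 * (W₃ * B₄ * W₁) - 2 * (W₃ * B₄ * W₂) + 2 * (W₃ * B₄ * W₃) + 2 * (W₃ * B₄ * W₄) + 2 * (W₃ * W₁ * B₄) -
            2 * (W₃ * W₂ * B₁) - 4 * (W₃ * W₂ * B₂) + 2 * (W₃ * W₂ * B₄) - 2 * (W₃ * W₄ * B₄) - 2 * (W₄ * B₁ * W₄) +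
            2 * (W₄ * B₂ * W₂) - 2 * (W₄ * B₂ * W₄) + 2 * (W₄ * B₃ * W₄) - 2 * (W₄ * B₄ * W₁) - 2 * (W₄ * B₄ * W₂) +
            2 * (W₄ * B₄ * W₃) + 2 * (W₄ * B₄ * W₄) - 2 * (W₄ * W₂ * B₁) - 2 * (W₄ * W₂ * B₂) + 2 * (W₄ * W₃ * B₁) +
            2 * (W₄ * W₃ * B₂) - 2 * (W₄ * W₃ * B₃) + 2 * (W₄ * W₄ * B₁) + 2 * (W₄ * W₄ * B₂) - 2 * (W₄ * W₄ * B₃) -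
            (W₄ * W₄ * B₄)),
        (W₁,
          2 * (B₃ * B₂ * W₂) + 2 * (B₄ * B₂ * W₂) + 2 * (B₄ * W₂ * B₁) + 2 * (B₄ * W₂ * B₂) - 2 * (B₄ * W₃ * B₁) -
            2 * (B₄ * W₃ * B₂) + 2 * (B₄ * W₃ * B₃) - 2 * (W₂ * B₁ * B₄) - 2 * (W₂ * B₂ * B₄) + 2 * (W₃ * B₁ * B₄) +
            2 * (W₃ * B₂ * B₄) - 2 * (W₃ * B₃ * B₄) + 2 * (W₄ * B₄ * B₄)),
        (W₂,
          2 * (B₂ * W₃ * B₁) + 2 * (B₂ * W₄ * B₁) - 2 * (B₃ * W₃ * B₂) - 2 * (B₃ * W₄ * B₁) - 4 * (B₃ * W₄ * B₂) -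
            2 * (B₄ * W₁ * B₁) - 2 * (B₄ * W₁ * B₂) + 2 * (B₄ * W₃ * B₃) - 2 * (B₄ * W₄ * B₁) + 2 * (W₁ * B₃ * B₂) +
            2 * (W₁ * B₄ * B₁) + 4 * (W₁ * B₄ * B₂) + 2 * (W₂ * B₁ * B₂) - 2 * (W₂ * B₁ * B₄) - 2 * (W₂ * B₂ * B₁) -
            2 * (W₂ * B₂ * B₄) + 2 * (W₂ * B₄ * B₁) + 2 * (W₂ * B₄ * B₂) - 2 * (W₃ * B₁ * B₂) + 2 * (W₃ * B₁ * B₄) +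
            2 * (W₃ * B₂ * B₄) + 4 * (W₃ * B₃ * B₂) - 2 * (W₃ * B₃ * B₄) - 2 * (W₃ * B₄ * B₁) + 2 * (W₄ * B₁ * B₁) +
            2 * (W₄ * B₂ * B₁) + 2 * (W₄ * B₂ * B₂) - 2 * (W₄ * B₃ * B₁) + 2 * (W₄ * B₃ * B₂) - 2 * (W₄ * B₄ * B₁) -
            2 * (W₄ * B₄ * B₂) + 2 * (W₄ * B₄ * B₄)),
        (W₃,
          -2 * (B₂ * W₂ * B₁) + 2 * (B₃ * B₂ * W₂) + 2 * (B₃ * W₂ * B₂) + 2 * (B₄ * B₂ * W₂) + 2 * (B₄ * W₁ * B₁) +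
            2 * (B₄ * W₁ * B₂) - 2 * (B₄ * W₁ * B₃) - 2 * (B₄ * W₂ * B₃) + 2 * (B₄ * W₄ * B₁) + 2 * (B₄ * W₄ * B₂) -
            2 * (B₄ * W₄ * B₃) - 2 * (W₁ * B₄ * B₁) - 2 * (W₁ * B₄ * B₂) + 2 * (W₁ * B₄ * B₃) + 2 * (W₂ * B₁ * B₄) +
            2 * (W₂ * B₂ * B₁) - 2 * (W₂ * B₂ * B₃) + 2 * (W₂ * B₂ * B₄) - 2 * (W₂ * B₄ * B₁) - 2 * (W₂ * B₄ * B₂) +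
            2 * (W₂ * B₄ * B₃) - 2 * (W₃ * B₁ * B₄) - 2 * (W₃ * B₂ * B₄) + 2 * (W₃ * B₃ * B₄) + 2 * (W₃ * B₄ * B₁) +
            2 * (W₃ * B₄ * B₂) - 2 * (W₃ * B₄ * B₃) - 2 * (W₄ * B₁ * B₁) - 2 * (W₄ * B₁ * B₂) + 2 * (W₄ * B₁ * B₃) -
            2 * (W₄ * B₂ * B₁) - 2 * (W₄ * B₂ * B₂) + 2 * (W₄ * B₂ * B₃) + 2 * (W₄ * B₃ * B₁) + 2 * (W₄ * B₃ * B₂) -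
            2 * (W₄ * B₃ * B₃) + 2 * (W₄ * B₄ * B₁) + 2 * (W₄ * B₄ * B₂) - 2 * (W₄ * B₄ * B₃) - 2 * (W₄ * B₄ * B₄)),
        (W₄,
          -2 * (B₂ * W₂ * B₁) + 2 * (B₃ * B₂ * W₂) - 2 * (B₃ * W₂ * B₁) + 2 * (B₄ * B₂ * W₂) + 4 * (B₄ * W₁ * B₁) +
            4 * (B₄ * W₁ * B₂) - 4 * (B₄ * W₁ * B₃) + 2 * (B₄ * W₂ * B₁) - 4 * (B₄ * W₂ * B₃) - 2 * (B₄ * W₃ * B₁) -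
            2 * (B₄ * W₃ * B₂) + 2 * (B₄ * W₃ * B₃) - 2 * (W₁ * B₁ * B₁) - 4 * (W₁ * B₁ * B₂) + 4 * (W₁ * B₁ * B₃) -
            2 * (W₁ * B₂ * B₂) + 4 * (W₁ * B₂ * B₃) - 2 * (W₁ * B₃ * B₃) - 2 * (W₂ * B₁ * B₂) + 2 * (W₂ * B₁ * B₃) -
            2 * (W₂ * B₁ * B₄) + 4 * (W₂ * B₂ * B₁) - 2 * (W₂ * B₃ * B₃) + 2 * (W₃ * B₁ * B₂) - 2 * (W₃ * B₁ * B₃) +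
            2 * (W₃ * B₁ * B₄) - 2 * (W₃ * B₂ * B₁) - 2 * (W₃ * B₂ * B₃) + 2 * (W₃ * B₂ * B₄) + 2 * (W₃ * B₃ * B₁) +
            2 * (W₃ * B₃ * B₂) - 2 * (W₃ * B₃ * B₄) + 2 * (W₄ * B₁ * B₂) - 2 * (W₄ * B₁ * B₃) + 2 * (W₄ * B₁ * B₄) -
            2 * (W₄ * B₂ * B₁) - 2 * (W₄ * B₂ * B₃) + 2 * (W₄ * B₂ * B₄) + 2 * (W₄ * B₃ * B₁) + 2 * (W₄ * B₃ * B₂) -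
            2 * (W₄ * B₃ * B₄) - 2 * (W₄ * B₄ * B₁) - 2 * (W₄ * B₄ * B₂) + 2 * (W₄ * B₄ * B₃))] ?_
  simp only [csum_cons, csum_nil, br]
  noncomm_ring

set_option maxHeartbeats 16000000 in
set_option maxRecDepth 100000 in
/-- **(R₂), SECOND KIND** (`α`-slots `1, 3`): `4·τP22(plaq W₂ (−W₃) W₄ (−W₁) B₂ (−B₃) B₄ (−B₁)) = 4·τP22(plaq W B) + 4·Pol τP21(W, E₁; B)
+ 2·Pol τquad∘wpart(W, D) + 4·τquad∘wpart(E₁)` with `E₁ = ([B₁,W₁], 0, [B₃,W₃], 0)`, `D = ([B₁,[B₁,W₁]], 0, [B₃,[B₃,W₃]], 0)`.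
Every ring, every tracial `τ`, all letters; collected difference 544 monomials, certificate 375. [folklore] -/
theorem four_smul_trace_P22_plaq_reflect₂ (hτ : ∀ a b : 𝔸, τ (a * b) = τ (b * a)) :
    (4 : 𝕜) • τ (P22 𝕜 (plaq W₂ (-W₃) W₄ (-W₁) B₂ (-B₃) B₄ (-B₁))) =
      (4 : 𝕜) • τ (P22 𝕜 (plaq W₁ W₂ W₃ W₄ B₁ B₂ B₃ B₄))
        + ((4 : 𝕜) • τ (P21 𝕜 (plaq (W₁ + (B₁ * W₁ - W₁ * B₁)) W₂ (W₃ + (B₃ * W₃ - W₃ * B₃)) W₄ B₁ B₂ B₃ B₄))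
            - (4 : 𝕜) • τ (P21 𝕜 (plaq W₁ W₂ W₃ W₄ B₁ B₂ B₃ B₄))
            - (4 : 𝕜) • τ (P21 𝕜 (plaq (B₁ * W₁ - W₁ * B₁) 0 (B₃ * W₃ - W₃ * B₃) 0 B₁ B₂ B₃ B₄)))
        + ((2 : 𝕜) • τ (quad 𝕜 (wpart (plaq (W₁ + (B₁ * (B₁ * W₁ - W₁ * B₁) - (B₁ * W₁ - W₁ * B₁) * B₁)) W₂
              (W₃ + (B₃ * (B₃ * W₃ - W₃ * B₃) - (B₃ * W₃ - W₃ * B₃) * B₃)) W₄ B₁ B₂ B₃ B₄)))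
            - (2 : 𝕜) • τ (quad 𝕜 (wpart (plaq W₁ W₂ W₃ W₄ B₁ B₂ B₃ B₄)))
            - (2 : 𝕜) • τ (quad 𝕜 (wpart (plaq (B₁ * (B₁ * W₁ - W₁ * B₁) - (B₁ * W₁ - W₁ * B₁) * B₁) 0
              (B₃ * (B₃ * W₃ - W₃ * B₃) - (B₃ * W₃ - W₃ * B₃) * B₃) 0 B₁ B₂ B₃ B₄))))
        + (4 : 𝕜) • τ (quad 𝕜 (wpart (plaq (B₁ * W₁ - W₁ * B₁) 0 (B₃ * W₃ - W₃ * B₃) 0 B₁ B₂ B₃ B₄))) := by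
  simp only [four_smul_trace_P22 𝕜 τ hτ, four_smul_trace_P21 𝕜 τ hτ, four_smul_trace_quad 𝕜 τ, two_smul_trace_quad 𝕜 τ,
    two_smul_twist₂_plaq, two_smul_qtwistAux, wpart_plaq, bpart_plaq, twist_plaq, sum_four_signed, two_smul_quad, commSum_four]
  simp only [plaq, ctwistAux_consW, ctwistAux_consB, ctwistAux_nil, twistAux_consW, twistAux_consB, twistAux_nil, wpart_consW,
    wpart_consB, wpart_nil, List.sum_cons, List.sum_nil]
  simp only [← map_add, ← map_sub]
  refine trace_eq_of_sub_eq_csum 𝕜 τ hτ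
    [(B₁,
          -(B₁ * W₁ * W₁) - 4 * (B₁ * W₁ * W₂) + 4 * (B₁ * W₁ * W₃) + 4 * (B₁ * W₁ * W₄) - 2 * (B₃ * W₃ * W₁) - 2 * (B₃ * W₃ * W₂)
            - 2 * (B₃ * W₃ * W₄) + 2 * (W₁ * B₁ * W₁) + 2 * (W₁ * B₁ * W₂) - 2 * (W₁ * B₁ * W₃) - 2 * (W₁ * B₁ * W₄) +
            2 * (W₁ * B₂ * W₁) + 2 * (W₁ * B₂ * W₃) + 2 * (W₁ * B₂ * W₄) - 2 * (W₁ * B₃ * W₁) + 2 * (W₁ * B₃ * W₃) -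
            2 * (W₁ * B₃ * W₄) - 2 * (W₁ * B₄ * W₁) - 2 * (W₁ * B₄ * W₄) - (W₁ * W₁ * B₁) - 2 * (W₁ * W₁ * B₂) + 2 * (W₁ * W₁ * B₃)
            + 2 * (W₁ * W₁ * B₄) - 2 * (W₁ * W₂ * B₁) - 2 * (W₁ * W₂ * B₂) + 2 * (W₁ * W₂ * B₃) + 2 * (W₁ * W₂ * B₄) +
            2 * (W₁ * W₃ * B₁) - 4 * (W₁ * W₃ * B₃) - 2 * (W₁ * W₃ * B₄) + 2 * (W₁ * W₄ * B₁) + 2 * (W₂ * B₁ * W₁) -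
            2 * (W₂ * B₁ * W₂) + 2 * (W₂ * B₁ * W₃) + 2 * (W₂ * B₁ * W₄) + 2 * (W₂ * B₂ * W₃) + 2 * (W₂ * B₂ * W₄) -
            2 * (W₂ * B₃ * W₄) - 2 * (W₂ * B₄ * W₄) - 2 * (W₂ * W₁ * B₁) - 2 * (W₂ * W₂ * B₂) + 2 * (W₂ * W₂ * B₃) +
            2 * (W₂ * W₂ * B₄) + 2 * (W₂ * W₃ * B₁) + 2 * (W₂ * W₃ * B₂) - 4 * (W₂ * W₃ * B₃) - 4 * (W₂ * W₃ * B₄) +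
            2 * (W₂ * W₄ * B₁) + 2 * (W₂ * W₄ * B₂) - 2 * (W₂ * W₄ * B₃) - 2 * (W₂ * W₄ * B₄) - 2 * (W₃ * B₁ * W₁) +
            2 * (W₃ * B₁ * W₂) - 2 * (W₃ * B₁ * W₃) - 2 * (W₃ * B₁ * W₄) - 2 * (W₃ * B₂ * W₃) - 2 * (W₃ * B₂ * W₄) +
            2 * (W₃ * B₃ * W₁) + 2 * (W₃ * B₃ * W₂) + 2 * (W₃ * B₃ * W₃) + 4 * (W₃ * B₃ * W₄) + 2 * (W₃ * B₄ * W₄) +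
            2 * (W₃ * W₁ * B₁) - 2 * (W₃ * W₂ * B₁) + 2 * (W₃ * W₃ * B₄) - 2 * (W₃ * W₄ * B₁) - 2 * (W₃ * W₄ * B₂) +
            2 * (W₃ * W₄ * B₃) + 2 * (W₃ * W₄ * B₄) - 2 * (W₄ * B₁ * W₁) + 2 * (W₄ * B₁ * W₂) - 2 * (W₄ * B₁ * W₃) -
            2 * (W₄ * B₁ * W₄) - 2 * (W₄ * B₂ * W₃) - 2 * (W₄ * B₂ * W₄) + 4 * (W₄ * B₃ * W₃) + 2 * (W₄ * B₃ * W₄) +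
            2 * (W₄ * B₄ * W₄) + 2 * (W₄ * W₁ * B₁) - 2 * (W₄ * W₂ * B₁) + 2 * (W₄ * W₃ * B₁) + 2 * (W₄ * W₃ * B₂) -
            4 * (W₄ * W₃ * B₃)),
        (B₂,
          -2 * (B₃ * W₃ * W₁) - 2 * (B₃ * W₃ * W₂) - 2 * (B₃ * W₃ * W₄) + 2 * (W₁ * B₁ * W₁) + 2 * (W₁ * B₁ * W₂) +
            2 * (W₁ * B₂ * W₁) - 2 * (W₁ * B₂ * W₃) - 2 * (W₁ * B₂ * W₄) - 2 * (W₁ * B₃ * W₁) + 2 * (W₁ * B₃ * W₃) +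
            2 * (W₁ * B₃ * W₄) - 2 * (W₁ * B₄ * W₁) + 2 * (W₁ * B₄ * W₄) + 2 * (W₁ * W₃ * B₂) - 2 * (W₁ * W₃ * B₃) +
            2 * (W₁ * W₄ * B₂) - 2 * (W₁ * W₄ * B₃) - 2 * (W₁ * W₄ * B₄) + 2 * (W₂ * B₁ * W₁) + 2 * (W₂ * B₁ * W₃) +
            2 * (W₂ * B₁ * W₄) + 2 * (W₂ * B₃ * W₃) - 2 * (W₂ * W₁ * B₁) - 2 * (W₂ * W₃ * B₃) - 2 * (W₃ * B₁ * W₁) -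
            2 * (W₃ * B₁ * W₃) - 2 * (W₃ * B₁ * W₄) - 2 * (W₃ * B₂ * W₁) + 4 * (W₃ * B₃ * W₁) + 2 * (W₃ * B₃ * W₂) +
            2 * (W₃ * B₃ * W₃) + 2 * (W₃ * B₃ * W₄) + 2 * (W₃ * B₄ * W₁) - 2 * (W₃ * W₁ * B₂) + 2 * (W₃ * W₁ * B₃) +
            2 * (W₃ * W₁ * B₄) - 2 * (W₃ * W₂ * B₁) + 2 * (W₃ * W₃ * B₁) - 2 * (W₃ * W₃ * B₃) + 2 * (W₃ * W₄ * B₁) -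
            2 * (W₄ * B₁ * W₁) - 2 * (W₄ * B₁ * W₃) - 2 * (W₄ * B₁ * W₄) - 2 * (W₄ * B₂ * W₁) + 2 * (W₄ * B₃ * W₁) +
            4 * (W₄ * B₃ * W₃) + 2 * (W₄ * B₄ * W₁) - 2 * (W₄ * W₁ * B₂) + 2 * (W₄ * W₁ * B₃) + 2 * (W₄ * W₁ * B₄) -
            2 * (W₄ * W₂ * B₁) + 2 * (W₄ * W₃ * B₁) - 4 * (W₄ * W₃ * B₃) + 2 * (W₄ * W₄ * B₁)),
        (B₃,
          2 * (B₃ * W₃ * W₁) + 2 * (B₃ * W₃ * W₂) - (B₃ * W₃ * W₃) - 2 * (W₁ * B₁ * W₁) - 2 * (W₁ * B₁ * W₂) + 2 * (W₁ * B₁ * W₃) -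
            2 * (W₁ * B₂ * W₁) + 4 * (W₁ * B₂ * W₃) + 2 * (W₁ * B₂ * W₄) + 2 * (W₁ * B₃ * W₁) - 2 * (W₁ * B₃ * W₃) -
            2 * (W₁ * B₃ * W₄) + 2 * (W₁ * B₄ * W₁) - 2 * (W₁ * B₄ * W₄) - 2 * (W₁ * W₃ * B₂) + 2 * (W₁ * W₃ * B₃) -
            2 * (W₁ * W₄ * B₂) + 2 * (W₁ * W₄ * B₃) + 2 * (W₁ * W₄ * B₄) - 2 * (W₂ * B₁ * W₁) + 2 * (W₂ * B₁ * W₃) -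
            2 * (W₂ * B₁ * W₄) - 2 * (W₂ * B₃ * W₃) + 2 * (W₂ * W₁ * B₁) + 2 * (W₂ * W₃ * B₃) + 2 * (W₃ * B₁ * W₁) -
            2 * (W₃ * B₁ * W₃) + 2 * (W₃ * B₁ * W₄) + 2 * (W₃ * B₂ * W₁) - 2 * (W₃ * B₂ * W₃) - 2 * (W₃ * B₃ * W₁) -
            2 * (W₃ * B₃ * W₂) + 2 * (W₃ * B₃ * W₃) + 4 * (W₃ * B₃ * W₄) + 2 * (W₃ * B₄ * W₄) - 2 * (W₃ * W₁ * B₁) -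
            2 * (W₃ * W₁ * B₄) - 2 * (W₃ * W₂ * B₁) - 2 * (W₃ * W₂ * B₄) + 2 * (W₃ * W₃ * B₁) + 2 * (W₃ * W₃ * B₂) - (W₃ * W₃ * B₃)
            + 2 * (W₃ * W₄ * B₁) + 2 * (W₃ * W₄ * B₂) - 4 * (W₃ * W₄ * B₃) - 4 * (W₃ * W₄ * B₄) + 2 * (W₄ * B₁ * W₁) -
            2 * (W₄ * B₁ * W₃) + 2 * (W₄ * B₁ * W₄) + 2 * (W₄ * B₂ * W₁) - 2 * (W₄ * B₂ * W₃) - 2 * (W₄ * B₃ * W₁) +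
            4 * (W₄ * B₃ * W₃) - 2 * (W₄ * B₄ * W₁) + 2 * (W₄ * W₁ * B₂) - 2 * (W₄ * W₁ * B₃) - 2 * (W₄ * W₁ * B₄) +
            2 * (W₄ * W₂ * B₁) - 2 * (W₄ * W₃ * B₁) + 4 * (W₄ * W₃ * B₃) - 2 * (W₄ * W₄ * B₁)),
        (B₄,
          -2 * (W₁ * B₁ * W₁) - 2 * (W₁ * B₁ * W₂) + 2 * (W₁ * B₁ * W₃) - 2 * (W₁ * B₂ * W₁) + 4 * (W₁ * B₂ * W₃) +
            2 * (W₁ * B₂ * W₄) + 2 * (W₁ * B₃ * W₁) - 2 * (W₁ * B₃ * W₃) - 2 * (W₁ * B₃ * W₄) + 2 * (W₁ * B₄ * W₁) -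
            2 * (W₁ * B₄ * W₄) - 2 * (W₁ * W₃ * B₂) + 2 * (W₁ * W₃ * B₃) - 2 * (W₁ * W₄ * B₂) + 2 * (W₁ * W₄ * B₃) +
            2 * (W₁ * W₄ * B₄) - 2 * (W₂ * B₁ * W₁) - 2 * (W₂ * B₁ * W₄) - 2 * (W₂ * B₃ * W₃) + 2 * (W₂ * W₁ * B₁) +
            2 * (W₂ * W₃ * B₃) + 2 * (W₃ * B₁ * W₁) + 2 * (W₃ * B₁ * W₄) + 2 * (W₃ * B₂ * W₁) - 2 * (W₃ * B₃ * W₁) -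
            2 * (W₃ * B₃ * W₂) - 4 * (W₃ * B₃ * W₄) - 2 * (W₃ * W₁ * B₁) + 2 * (W₄ * B₁ * W₁) + 2 * (W₄ * B₁ * W₄) +
            2 * (W₄ * B₂ * W₁) - 2 * (W₄ * B₃ * W₁) - 2 * (W₄ * B₃ * W₃) - 2 * (W₄ * B₄ * W₁) + 2 * (W₄ * W₁ * B₂) -
            2 * (W₄ * W₁ * B₃) - 2 * (W₄ * W₁ * B₄) + 2 * (W₄ * W₂ * B₁) - 2 * (W₄ * W₃ * B₁) + 4 * (W₄ * W₃ * B₃) -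
            2 * (W₄ * W₄ * B₁)),
        (W₁,
          2 * (B₂ * W₃ * B₁) + 2 * (B₂ * W₄ * B₁) + 2 * (B₃ * W₃ * B₂) - 2 * (B₃ * W₄ * B₁) - 2 * (B₄ * B₃ * W₃) +
            2 * (B₄ * W₃ * B₂) - 2 * (B₄ * W₄ * B₁) + 2 * (W₁ * B₁ * B₂) - 2 * (W₁ * B₁ * B₃) - 2 * (W₁ * B₁ * B₄) -
            2 * (W₁ * B₂ * B₁) + 2 * (W₁ * B₂ * B₃) + 2 * (W₁ * B₂ * B₄) + 2 * (W₁ * B₃ * B₁) - 2 * (W₁ * B₃ * B₂) -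
            2 * (W₁ * B₃ * B₄) + 2 * (W₁ * B₄ * B₁) - 2 * (W₁ * B₄ * B₂) + 2 * (W₁ * B₄ * B₃) - 2 * (W₂ * B₁ * B₁) -
            2 * (W₂ * B₂ * B₁) - 2 * (W₂ * B₂ * B₂) + 4 * (W₂ * B₂ * B₃) + 4 * (W₂ * B₂ * B₄) + 2 * (W₂ * B₃ * B₁) -
            2 * (W₂ * B₃ * B₃) - 4 * (W₂ * B₃ * B₄) + 2 * (W₂ * B₄ * B₁) - 2 * (W₂ * B₄ * B₄) + 2 * (W₃ * B₁ * B₁) -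
            2 * (W₃ * B₂ * B₃) - 2 * (W₃ * B₂ * B₄) - 2 * (W₃ * B₃ * B₁) + 2 * (W₃ * B₃ * B₃) + 4 * (W₃ * B₃ * B₄) -
            2 * (W₃ * B₄ * B₁) + 2 * (W₃ * B₄ * B₄) + 2 * (W₄ * B₁ * B₁) - 2 * (W₄ * B₂ * B₃) - 2 * (W₄ * B₂ * B₄) +
            2 * (W₄ * B₃ * B₂) + 2 * (W₄ * B₃ * B₄) + 2 * (W₄ * B₄ * B₂) - 2 * (W₄ * B₄ * B₃)),
        (W₂,
          2 * (B₂ * B₁ * W₁) - 2 * (B₂ * W₃ * B₁) - 2 * (B₂ * W₄ * B₁) - 2 * (B₃ * B₁ * W₁) - 2 * (B₃ * W₃ * B₁) +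
            2 * (B₃ * W₄ * B₁) - 2 * (B₄ * B₁ * W₁) - 2 * (B₄ * B₃ * W₃) + 2 * (B₄ * W₄ * B₁) + 2 * (W₃ * B₂ * B₁) +
            2 * (W₃ * B₃ * B₁) + 2 * (W₄ * B₂ * B₁) - 2 * (W₄ * B₃ * B₁) - 2 * (W₄ * B₄ * B₁)),
        (W₃,
          -2 * (B₂ * B₁ * W₁) + 2 * (B₂ * W₁ * B₁) + 2 * (B₂ * W₂ * B₁) + 2 * (B₃ * B₁ * W₁) + 2 * (B₃ * W₁ * B₂) +
            2 * (B₃ * W₂ * B₁) - 4 * (B₃ * W₄ * B₁) - 2 * (B₃ * W₄ * B₂) + 8 * (B₃ * W₄ * B₃) + 2 * (B₄ * B₁ * W₁) +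
            2 * (B₄ * W₁ * B₂) - 2 * (B₄ * W₄ * B₁) + 2 * (B₄ * W₄ * B₃) - 2 * (W₁ * B₁ * B₂) - 2 * (W₁ * B₂ * B₂) +
            2 * (W₁ * B₃ * B₂) + 2 * (W₁ * B₄ * B₂) - 2 * (W₁ * B₄ * B₃) - 2 * (W₂ * B₁ * B₂) - 2 * (W₂ * B₁ * B₃) -
            2 * (W₂ * B₄ * B₃) + 2 * (W₃ * B₁ * B₂) + 2 * (W₃ * B₁ * B₃) - 2 * (W₃ * B₂ * B₁) + 2 * (W₃ * B₂ * B₃) -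
            2 * (W₃ * B₃ * B₁) - 2 * (W₃ * B₃ * B₂) + 2 * (W₄ * B₁ * B₂) + 2 * (W₄ * B₁ * B₃) - 2 * (W₄ * B₂ * B₁) +
            2 * (W₄ * B₂ * B₃) + 2 * (W₄ * B₃ * B₁) - 4 * (W₄ * B₃ * B₃) + 2 * (W₄ * B₄ * B₁) - 4 * (W₄ * B₄ * B₃)),
        (W₄,
          -2 * (B₂ * B₁ * W₁) + 2 * (B₂ * W₁ * B₁) + 2 * (B₂ * W₂ * B₁) + 2 * (B₃ * B₁ * W₁) - 2 * (B₃ * W₁ * B₁) -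
            2 * (B₃ * W₂ * B₁) + 4 * (B₃ * W₃ * B₁) + 2 * (B₃ * W₃ * B₂) + 2 * (B₄ * B₁ * W₁) - 2 * (B₄ * B₃ * W₃) -
            2 * (B₄ * W₁ * B₁) - 2 * (B₄ * W₂ * B₁) + 2 * (B₄ * W₃ * B₁) - 2 * (B₄ * W₃ * B₃) - 2 * (W₁ * B₁ * B₂) +
            2 * (W₁ * B₁ * B₃) + 2 * (W₁ * B₁ * B₄) - 2 * (W₁ * B₂ * B₂) + 2 * (W₁ * B₂ * B₃) + 2 * (W₁ * B₂ * B₄) +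
            2 * (W₁ * B₃ * B₂) - 2 * (W₁ * B₃ * B₃) - 2 * (W₁ * B₃ * B₄) + 2 * (W₁ * B₄ * B₂) - 2 * (W₁ * B₄ * B₃) -
            2 * (W₁ * B₄ * B₄) - 2 * (W₂ * B₁ * B₂) + 2 * (W₂ * B₁ * B₃) + 2 * (W₂ * B₁ * B₄) + 2 * (W₃ * B₁ * B₂) -
            2 * (W₃ * B₁ * B₃) - 2 * (W₃ * B₁ * B₄) - 2 * (W₃ * B₂ * B₁) - 2 * (W₃ * B₃ * B₁) - 2 * (W₃ * B₃ * B₂) +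
            4 * (W₃ * B₃ * B₃) + 2 * (W₃ * B₃ * B₄) + 2 * (W₄ * B₁ * B₂) - 2 * (W₄ * B₁ * B₃) - 2 * (W₄ * B₁ * B₄) -
            2 * (W₄ * B₂ * B₁) + 2 * (W₄ * B₃ * B₁) + 2 * (W₄ * B₄ * B₁))] ?_
  simp only [csum_cons, csum_nil, br]
  noncomm_ring

end Summit.QuantumFields.BalabanUV.Beta.WilsonJetReflect2Plaq
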